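import Summits.CriticalPhenomena.PercolationContinuityZ3.Theorems.Transplant.BoxProdZ2Boxes
import HarnessLib

/-!
# F6-prod, seed geometry in the FIBRE: balls of bounded size, the inward retraction of a window point, and the fibre part of a THICK seed
# (BLUEPRINT-I-PHI §1 rows "Step III seeds", "cube behind a contact", §6 Target 1)

builds on p205010 (kernel theorem, internal audit signed; external expert review pending) — nothing in this file uses p205010.
Lane `prim-bschramm`, seat `prim-bschramm-p3` (task F6 (b): the `X □ ℤ²` seed kit, split agreed with p2-g2 07:45Z/07:55Z); helper file
(`--supports stmt-CriticalPhenomena-4575 --as helper`).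

Kozma–Nitzan's seeds (arXiv:2401.12397 §4 p. 19) are planar: a plaquette in the face of `B⟨j⟩` plus the edges into the face `U(P)` of the
cube behind it.  Over `X □ ℤ²` the cube behind a macro contact `x = (w, t)` is a fibre-fat prism `B_X(c, n) × (planar cube)`, so the seed
must also carry the contact's slice `{w} × ℤ²` to the whole fibre ball `B_X(c, n)`: it contains, at each plaquette height, all `X`-edges
inside a connected fibre set `fibSet ∋ w` with `B_X(c, n) ⊆ fibSet ⊆ window`.  For the window `B_X(x_e, R)` the centre `c` is obtained by
RETRACTING `w` towards `x_e` by `n + 1` steps along a walk of length `≤ R` (so that `B_X(c, n)` stays inside the window although `w` may lie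
at its edge).  This file is pure graph geometry of a locally finite `X` with degrees `≤ Δ`:
* §1 `card_ballFin_le`: `|B_X(x, n)| ≤ (Δ+1)^n`; symmetry and triangle inequality for `ballFin`; paths along walks;
* §2 `fibCtr` / `fibSet` (the retraction and the fibre set of a window point) with: containment in the window (`fibSet_subset_window`),
  `B_X(c, n) ⊆ fibSet`, `w ∈ fibSet`, localisation `fibSet ⊆ B_X(w, 2n+1)`, connectedness from `w` inside `fibSet` (`pathIn_fibSet`), and
  the size bound `card_fibSet_le`.

[cite: KozmaNitzan2024, §4 Lemma 10, p. 19 (seeds), p. 21 (v(P), U(P)) — the ℤ^d model] [cite: GrimmettPercolation1999, §7.2]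
-/

noncomputable section

namespace Summit.CriticalPhenomena.PercolationContinuityZ3.Theorems

namespace Transplant

namespace BoxProdZ2

open Literature.Probability.Percolation Literature.Probability.LatticeModels SimpleGraph
open Literature.Barriers.CriticalPhenomena (graphBall graphBall_finite mem_graphBall_self graphBall_mono)

variable {W : Type*} (X : SimpleGraph W) [X.LocallyFinite]

/-! ## §1 Fibre balls: size, symmetry, triangle inequality; paths along walks -/

/-- A vertex at the end of a walk of length `≤ n + 1` is in the ball of radius `n` or adjacent to a vertex of it. [folklore] -/
theorem mem_ballFin_succ_iff [DecidableEq W] {x y : W} {n : ℕ} :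
    y ∈ ballFin X x (n + 1) ↔ y ∈ ballFin X x n ∨ ∃ z ∈ ballFin X x n, X.Adj z y := by
  constructor
  · intro hy
    obtain ⟨p, hp⟩ := (mem_ballFin X).1 hy
    by_cases hlen : p.length ≤ n
    · exact Or.inl ((mem_ballFin X).2 ⟨p, hlen⟩)
    · right
      have hlen' : p.length = n + 1 := by omega
      refine ⟨p.getVert n, (mem_ballFin X).2 ⟨p.take n, by rw [Walk.take_length]; omega⟩, ?_⟩
      have h := p.adj_getVert_succ (i := n) (by omega)
      rwa [← hlen', Walk.getVert_length] at h
  · rintro (hy | ⟨z, hz, hzy⟩)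
    · exact ballFin_mono X x (Nat.le_succ n) hy
    · exact (mem_ballFin X).2 (mem_graphBall_succ_of_adj X ((mem_ballFin X).1 hz) hzy)

/-- **Balls of a graph with degrees `≤ Δ` have at most `(Δ+1)^n` vertices.** [folklore] -/
theorem card_ballFin_le [DecidableEq W] {Δ : ℕ} (hΔ : ∀ w, X.degree w ≤ Δ) (x : W) :
    ∀ n : ℕ, (ballFin X x n).card ≤ (Δ + 1) ^ n := by
  intro n
  induction n with
  | zero =>
    rw [pow_zero, Finset.card_le_one]
    intro a ha b hb
    obtain ⟨p, hp⟩ := (mem_ballFin X).1 ha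
    obtain ⟨q, hq⟩ := (mem_ballFin X).1 hb
    have h1 := (Walk.eq_of_length_eq_zero (Nat.le_zero.1 hp)).symm
    have h2 := (Walk.eq_of_length_eq_zero (Nat.le_zero.1 hq)).symm
    rw [h1, h2]
  | succ n ih =>
    have hsub : ballFin X x (n + 1) ⊆ ballFin X x n ∪ (ballFin X x n).biUnion fun z => X.neighborFinset z := by
      intro y hy
      rcases (mem_ballFin_succ_iff X).1 hy with h | ⟨z, hz, hzy⟩
      · exact Finset.mem_union_left _ h
      · exact Finset.mem_union_right _ (Finset.mem_biUnion.2 ⟨z, hz, (SimpleGraph.mem_neighborFinset _ _ _).2 hzy⟩)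
    calc (ballFin X x (n + 1)).card ≤ (ballFin X x n ∪ (ballFin X x n).biUnion fun z => X.neighborFinset z).card :=
          Finset.card_le_card hsub
      _ ≤ (ballFin X x n).card + ((ballFin X x n).biUnion fun z => X.neighborFinset z).card := Finset.card_union_le _ _
      _ ≤ (ballFin X x n).card + ∑ z ∈ ballFin X x n, (X.neighborFinset z).card := by
          have := Finset.card_biUnion_le (s := ballFin X x n) (t := fun z => X.neighborFinset z); omega
      _ ≤ (ballFin X x n).card + ∑ _z ∈ ballFin X x n, Δ := by
          refine Nat.add_le_add_left (Finset.sum_le_sum fun z _ => ?_) _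
          rw [SimpleGraph.card_neighborFinset_eq_degree]; exact hΔ z
      _ = (ballFin X x n).card * (Δ + 1) := by rw [Finset.sum_const, smul_eq_mul]; ring
      _ ≤ (Δ + 1) ^ n * (Δ + 1) := Nat.mul_le_mul_right _ ih
      _ = (Δ + 1) ^ (n + 1) := by rw [pow_succ]

omit [X.LocallyFinite] in
/-- Balls are symmetric: `y ∈ B(x, n) ↔ x ∈ B(y, n)`. [folklore] -/
theorem mem_graphBall_comm {x y : W} {n : ℕ} : y ∈ graphBall X x n ↔ x ∈ graphBall X y n :=
  ⟨fun ⟨p, hp⟩ => ⟨p.reverse, by rw [Walk.length_reverse]; exact hp⟩,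
    fun ⟨p, hp⟩ => ⟨p.reverse, by rw [Walk.length_reverse]; exact hp⟩⟩

omit [X.LocallyFinite] in
/-- Triangle inequality for balls. [folklore] -/
theorem mem_graphBall_add {x y z : W} {m n : ℕ} (hy : y ∈ graphBall X x m) (hz : z ∈ graphBall X y n) :
    z ∈ graphBall X x (m + n) := by
  obtain ⟨p, hp⟩ := hy
  obtain ⟨q, hq⟩ := hz
  exact ⟨p.append q, by rw [Walk.length_append]; omega⟩

omit [X.LocallyFinite] in
/-- The `i`-th vertex of a walk of length `≤ R` from `x` lies in `B(x, i)` and in `B(x, R)`. [folklore] -/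
theorem getVert_mem_graphBall {x y : W} (p : X.Walk x y) (i : ℕ) : p.getVert i ∈ graphBall X x i :=
  ⟨p.take i, by rw [Walk.take_length]; exact min_le_left _ _⟩

omit [X.LocallyFinite] in
/-- The `i`-th vertex of a walk is within `length - i` of its end. [folklore] -/
theorem getVert_mem_graphBall_end {x y : W} (p : X.Walk x y) (i : ℕ) : p.getVert i ∈ graphBall X y (p.length - i) := by
  rw [mem_graphBall_comm]
  exact ⟨p.drop i, by rw [Walk.drop_length]⟩

omit [X.LocallyFinite] in
/-- **Every vertex of a walk is joined to its start by a path inside the walk's support.** [folklore] -/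
theorem pathIn_support_of_walk {a b : W} (q : X.Walk a b) : ∀ v ∈ q.support, PathIn X {u | u ∈ q.support} a v := by
  induction q with
  | nil =>
    intro v hv
    rw [Walk.support_nil, List.mem_singleton] at hv
    subst hv
    exact PathIn.refl (by simp)
  | @cons a a' b hadj q ih =>
    intro v hv
    rw [Walk.support_cons, List.mem_cons] at hv
    have hsub : {u | u ∈ q.support} ⊆ {u | u ∈ (Walk.cons hadj q).support} := fun u hu => by
      rw [Set.mem_setOf_eq, Walk.support_cons]; exact List.mem_cons_of_mem _ hu
    have ha : a ∈ {u | u ∈ (Walk.cons hadj q).support} := by simp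
    rcases hv with rfl | hv
    · exact PathIn.refl ha
    · exact (PathIn.of_adj ha (hsub q.start_mem_support) hadj).trans ((ih v hv).mono hsub)

/-! ## §2 The inward retraction of a window point and the fibre set of a thick seed -/

omit [X.LocallyFinite] in
/-- A chosen walk of length `≤ R` from the window centre `xe` to a point `w ∈ B(xe, R)`. [folklore] -/
def winWalk {xe w : W} {R : ℕ} (hw : w ∈ graphBall X xe R) : X.Walk xe w := Classical.choose hw

omit [X.LocallyFinite] in
/-- The chosen walk has length `≤ R`. [folklore] -/
theorem winWalk_length {xe w : W} {R : ℕ} (hw : w ∈ graphBall X xe R) : (winWalk X hw).length ≤ R :=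
  Classical.choose_spec hw

omit [X.LocallyFinite] in
/-- **The retracted centre** `c(w)`: the vertex `n + 1` steps before `w` on the chosen walk from `xe` (or `xe` itself if the walk is
shorter) — the fibre centre of the cube behind a contact with fibre coordinate `w`. [cite: KozmaNitzan2024, §4 p. 21 (v(P))] -/
def fibCtr {xe w : W} {R : ℕ} (hw : w ∈ graphBall X xe R) (n : ℕ) : W :=
  (winWalk X hw).getVert ((winWalk X hw).length - (n + 1))

/-- **The fibre set of the thick seed** of a contact with fibre coordinate `w`: the last `≤ n + 1` steps of the chosen walk (from `c(w)`
to `w`) together with the ball `B_X(c(w), n)`. [cite: KozmaNitzan2024, §4 p. 19 (seeds)] -/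
def fibSet [DecidableEq W] {xe w : W} {R : ℕ} (hw : w ∈ graphBall X xe R) (n : ℕ) : Finset W :=
  ((winWalk X hw).drop ((winWalk X hw).length - (n + 1))).support.toFinset ∪ ballFin X (fibCtr X hw n) n

omit [X.LocallyFinite] in
/-- The retracted centre lies in `B(xe, length - (n+1))`. [folklore] -/
theorem fibCtr_mem_graphBall {xe w : W} {R : ℕ} (hw : w ∈ graphBall X xe R) (n : ℕ) :
    fibCtr X hw n ∈ graphBall X xe ((winWalk X hw).length - (n + 1)) :=
  getVert_mem_graphBall X _ _

omit [X.LocallyFinite] in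
/-- **The cube's fibre ball fits in the window**: `B_X(c(w), n) ⊆ B_X(xe, R)` (`n ≤ R`). [cite: KozmaNitzan2024, §4 p. 19 ("v + [-M,M]^d ⊆ S")] -/
theorem graphBall_fibCtr_subset_window {xe w : W} {R : ℕ} (hw : w ∈ graphBall X xe R) {n : ℕ} (hn : n ≤ R) :
    graphBall X (fibCtr X hw n) n ⊆ graphBall X xe R := by
  intro b hb
  have h := mem_graphBall_add X (fibCtr_mem_graphBall X hw n) hb
  refine graphBall_mono X xe ?_ h
  have := winWalk_length X hw
  omega

omit [X.LocallyFinite] in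
/-- The retracted centre is within `n + 1` of `w`. [folklore] -/
theorem fibCtr_mem_graphBall_self {xe w : W} {R : ℕ} (hw : w ∈ graphBall X xe R) (n : ℕ) :
    fibCtr X hw n ∈ graphBall X w (n + 1) := by
  refine graphBall_mono X w ?_ (getVert_mem_graphBall_end X (winWalk X hw) _)
  omega

/-- `w` itself lies in its fibre set. [folklore] -/
theorem self_mem_fibSet [DecidableEq W] {xe w : W} {R : ℕ} (hw : w ∈ graphBall X xe R) (n : ℕ) : w ∈ fibSet X hw n :=
  Finset.mem_union_left _ (List.mem_toFinset.2 (Walk.end_mem_support _))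

/-- The retracted centre lies in the fibre set. [folklore] -/
theorem fibCtr_mem_fibSet [DecidableEq W] {xe w : W} {R : ℕ} (hw : w ∈ graphBall X xe R) (n : ℕ) : fibCtr X hw n ∈ fibSet X hw n :=
  Finset.mem_union_left _ (List.mem_toFinset.2 (Walk.start_mem_support _))

/-- The cube's fibre ball lies in the fibre set. [folklore] -/
theorem ballFin_fibCtr_subset_fibSet [DecidableEq W] {xe w : W} {R : ℕ} (hw : w ∈ graphBall X xe R) (n : ℕ) :
    ballFin X (fibCtr X hw n) n ⊆ fibSet X hw n :=
  Finset.subset_union_right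

/-- **The fibre set lies in the window** `B_X(xe, R)` (`n ≤ R`). [folklore] -/
theorem fibSet_subset_window [DecidableEq W] {xe w : W} {R : ℕ} (hw : w ∈ graphBall X xe R) {n : ℕ} (hn : n ≤ R) :
    fibSet X hw n ⊆ ballFin X xe R := by
  intro b hb
  rw [mem_ballFin]
  rcases Finset.mem_union.1 hb with hb | hb
  · rw [List.mem_toFinset, Walk.mem_support_iff_exists_getVert] at hb
    obtain ⟨i, rfl, hi⟩ := hb
    rw [Walk.drop_getVert]
    exact graphBall_mono X xe (by have := winWalk_length X hw; rw [Walk.drop_length] at hi; omega)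
      (getVert_mem_graphBall X (winWalk X hw) _)
  · exact graphBall_fibCtr_subset_window X hw hn ((mem_ballFin X).1 hb)

/-- **Localisation**: the fibre set lies in `B_X(w, 2n + 1)`. [folklore] -/
theorem fibSet_subset_ballFin_self [DecidableEq W] {xe w : W} {R : ℕ} (hw : w ∈ graphBall X xe R) (n : ℕ) :
    fibSet X hw n ⊆ ballFin X w (2 * n + 1) := by
  intro b hb
  rw [mem_ballFin]
  rcases Finset.mem_union.1 hb with hb | hb
  · rw [List.mem_toFinset, Walk.mem_support_iff_exists_getVert] at hb
    obtain ⟨i, rfl, hi⟩ := hb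
    rw [Walk.drop_getVert]
    refine graphBall_mono X w ?_ (getVert_mem_graphBall_end X (winWalk X hw) _)
    omega
  · have h := mem_graphBall_add X (fibCtr_mem_graphBall_self X hw n) ((mem_ballFin X).1 hb)
    exact graphBall_mono X w (by omega) h

/-- **Connectedness of the fibre set from `w`**: every vertex of the fibre set is joined to `w` by a path of `X` inside it. [folklore] -/
theorem pathIn_fibSet [DecidableEq W] {xe w : W} {R : ℕ} (hw : w ∈ graphBall X xe R) (n : ℕ) {b : W} (hb : b ∈ fibSet X hw n) :
    PathIn X (↑(fibSet X hw n) : Set W) w b := by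
  set q := (winWalk X hw).drop ((winWalk X hw).length - (n + 1)) with hq
  have hsupp : {u | u ∈ q.support} ⊆ (↑(fibSet X hw n) : Set W) := fun u hu =>
    Finset.mem_coe.2 (Finset.mem_union_left _ (List.mem_toFinset.2 hu))
  -- from `w` back to the centre along the walk
  have hcw : PathIn X (↑(fibSet X hw n) : Set W) w (fibCtr X hw n) :=
    ((pathIn_support_of_walk X q w q.end_mem_support).mono hsupp).symm
  rcases Finset.mem_union.1 hb with hb' | hb'
  · exact hcw.trans ((pathIn_support_of_walk X q b (List.mem_toFinset.1 hb')).mono hsupp)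
  · exact hcw.trans ((pathIn_ballFin_center X (fibCtr X hw n) n ((mem_ballFin X).1 hb')).mono
      (Finset.coe_subset.2 (ballFin_fibCtr_subset_fibSet X hw n)))

/-- **Size of the fibre set**: at most `n + 2 + (Δ+1)^n` vertices. [folklore] -/
theorem card_fibSet_le [DecidableEq W] {Δ : ℕ} (hΔ : ∀ w, X.degree w ≤ Δ) {xe w : W} {R : ℕ} (hw : w ∈ graphBall X xe R) (n : ℕ) :
    (fibSet X hw n).card ≤ n + 2 + (Δ + 1) ^ n := by
  refine (Finset.card_union_le _ _).trans (add_le_add ?_ (card_ballFin_le X hΔ _ n))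
  refine (List.toFinset_card_le _).trans ?_
  rw [Walk.length_support, Walk.drop_length]
  omega

end BoxProdZ2

end Transplant

end Summit.CriticalPhenomena.PercolationContinuityZ3.Theorems

end
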